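/-
Copyright: statement-level skeleton of a published paper (lit-balaban cell, Phase-2 proof seat p19, gen 3). No claims beyond
what the kernel checks below.
-/
import Mathlib
import Literature.MathematicalPhysics.QuantumFieldTheory.Balaban1983to89.B3Ineq213TreeLength
import Literature.MathematicalPhysics.QuantumFieldTheory.Balaban1983to89.B3Ineq215Proof

/-!
# B3 — T. Bałaban, *(Higgs)₂,₃ quantum fields in a finite volume. III. Renormalization*, CMP **88** (1983) 411–445
[Balaban1983Higgs3] — Sect. 2, p. 426: the concrete class of localized lattice graph amplitudes of the first estimate
(2.13), and the estimate of ONE localized term (absolute values, vertex and line bounds, split of the exponentials)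

statement-level skeleton of published theorems with citation tags; proofs where landed; nothing here is a claim about
the Yang–Mills mass gap

PDF held: `paper:balaban1983-higgs-2-3-quantum-fields-finite-volume` (journal page = PDF page + 410); displays read on
the ×2 renders `pub-balaban/b2b-balaban-ref1/pages/1983-cmp88-higgs23-III/1983-cmp88-higgs23-III-p010, p014 … p017-x2.png`
(pp. 420, 424–427).

Part of the Phase-2 proof of SKELETON row **B3.Eq2.13-2.14** (unit `lit-balaban-p19` gen 3, HOME
`run/shared/lean/pub/lit-balaban/`): files `B3Ineq213Points` → `B3Ineq213TreeLength` → `B3Ineq213Amplitude` →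
`B3Ineq213Proof` (the theorems `Amp.abs_E_le`, `Amp.ineq213`, `Amp.bound133`), sub-namespace `…Balaban1983to89.B3Ineq213`;
the row was typed by r15 as the claim `B3Sect2FirstEstimate.Ineq213` (p243824) with the values `E(G(j), {□(v)}, Φ′_ext,
A_ext)` supplied abstractly; the weight (2.14) is the gen-2 `B3Ineq215.Model.W` (`B3Ineq215Degrees`/`Reroute`), the index sets
`J(l̃)` = `B3Ineq215.Model.Mon m k` (`B3Ineq215Proof`).

WHAT IS REPRODUCED.  p. 426 [PDF 16], the derivation of **(2.13)**, verbatim: *"In the next step we make a first estimate of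
the expression. We estimate it taking absolute values of all factors. The external fields are estimated further by the
Hölder norms and for the operators δG_k and (1.16) we apply the inequality (2.5). For the propagators G^η_{(j)} we apply the
inequality |G^η_{(j)}(Ω, B̃; x, x′)| ≦ O(1)(L^jη)^{−d+2}e^{−δ₁(L^jη)^{−1}|x−x′|}, (2.10) and if the propagator is differentiated,
then for each differentiation, there is an additional factor (L^jη)^{−1} on the right side. … For each such expression
[an averaged vector leg] we have an additional factor L^jη on the right side … Finally in vertices we apply the inequalities
|q| ≦ 1, |R_{n̄+1}(·)| ≦ 1. … For each line we extract a part of the exponential factors on the right sides of (2.5), (2.10),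
and (2.12) and we estimate them by exp[−½δ₁dist(□(v), □(v′))], where □(v), □(v′) are localizations of endpoints of the
line."*  KERNEL-CHECKED HERE for the concrete class `Amp M` of LOCALIZED LATTICE GRAPH AMPLITUDES which this paragraph
manipulates (the generalized graph `M : B3Ineq215.Model V m` of Proposition 2.2 — lines `l(1), …, l(m)` with endpoints,
vertex η-powers `e_v ≥ 0`, line dimensions `a_l`; `d`, `L`, `δ₀ = ½δ₁`): the value at the scale assignment `j` is the
lattice sum `E_j = Σ_{x_v ∈ □(v) ∩ T_η, v ∈ G} Π_v η^d u_v(x_v) · Π_l K_l(j_l; x_{v_l}, x_{v′_l})` (`Amp.E`) over the positions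
of the vertices in their unit cubes `□(v)`, where (i) the VERTEX FUNCTIONS `u_v` (the product of everything attached to `v`:
external fields `hΦ_ext`, `h′A_ext`, couplings, the tensors `q`, `R_{n̄+1}`, the extra factors `η`) obey `|u_v(x)| ≤
e^{d_v(v)} λ^{d_s(v)} N^Φ_v N^A_v η^{e_v}` (`d_v(v)`, `d_s(v)` the orders of `v` in `e`, `λ`, p. 420; `N^Φ_v`, `N^A_v ≥ 0`
the norms of the external fields localized at `v`); (ii) the LINE KERNELS obey (2.10)–(2.12) in the form fed into (2.14):
`|K_l(t; x, x′)| ≤ C_l (L^tη)^{a_l} e^{−δ₁(L^tη)^{−1}|x−x′|}` for `t < k` (`a_l` = the total power of `L^{j_l}η` the line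
carries: `−(d−2)/2` per leg, `−1` per differentiation, `+1` per averaged vector leg, cf. `B3Ineq215.Counts.lineDim`);
(iii) the graph is connected (Proposition 2.1).  PROVED here: the estimate of ONE localized term (`Amp.abs_term_le`):
for `x_v ∈ □(v)`, `|Π_v η^d u_v(x_v) Π_l K_l(j_l; x_{v_l}, x_{v′_l})| ≤ (Π_v cw_v)(Π_l C_l (L^{j_l}η)^{a_l}) exp[−½δ₁ d({□(v)})]
· (Π_v η^d η^{e_v}) · Π_l exp[−½δ₁(L^{j_l}η)^{−1}dist(Δ(v_l), Δ(v′_l))]` with `Δ(v)` the cube of scale `j(v)` containing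
`x_v` (`Amp.loc`) — via `abs_K_le` (one line: (2.10)–(2.12) and the split of the exponential, using `(L^{j_l}η)^{−1} ≥ 1`
and `|x − x′| ≥ dist(Δ(v), Δ(v′))`, `B3Ineq213Points.distI_anc_pt_le`), `prod_abs_K_le`, `abs_vertex_le`, and the tree
length extraction `B3Ineq213TreeLength.exp_sum_lines_le`.  The summation over the positions ((2.13) itself) is in
`B3Ineq213Proof`.  Reading choices (docstrings of files 1–2): positions on `ηℤ^d_{≥0}` in η-units, sup-norm distances,
`dist(Δ, Δ′)` of (2.14) = the sup-distance of the gen-2 cubes.  Not modelled (outside the displayed mechanism): the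
derivation of the hypotheses (i)–(ii) from the concrete vertices (1.6)–(1.16) and from Propositions I.2.1/I.2.3 (rows
B3.Eq2.5, B3.Eq2.10–2.12, typed in `B3Sect2StatementsPart2`).
-/

open Finset

namespace Literature.MathematicalPhysics.QuantumFieldTheory.Balaban1983to89.B3Ineq213

open B3Ineq215

/-! ## The concrete class of localized lattice graph amplitudes -/

/-- The data of a LOCALIZED LATTICE GRAPH AMPLITUDE as manipulated on p. 426 [PDF 16], over the generalized graph `M` of
Proposition 2.2 (lines `l(1), …, l(m)` = `Fin m` with endpoints `M.src`, `M.tgt`, vertex η-powers `M.e`, line dimensions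
`M.a`, constants `d`, `L`, `δ₀ = ½δ₁`): the number `k` of completed steps (`η = L^{−k}`), the unit cubes `□(v)` (`box`),
the vertex functions `u_v` and line kernels `K_l(t; x, x′)` on the η-lattice (positions in η-units), the kernel constants
`C_l ≥ 0` = the O(1) of (2.10)–(2.12), the running couplings `e = e(L^kε)`, `λ = λ(L^kε)` with the orders `d_v(v)`, `d_s(v)`
of the vertices (p. 420), the norms `N^Φ_v`, `N^A_v` of the external fields localized at `v`, and the three hypotheses of
the printed derivation: the graph is connected, *"The external fields are estimated further by the Hölder norms … in
vertices we apply the inequalities |q| ≦ 1, |R_{n̄+1}(·)| ≦ 1"* (`u_le`, with the vertex's *"proper power"* `η^{e_v}`), and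
the line bounds (2.10)–(2.12) with the differentiation / averaged-leg factors collected in `a_l` (`K_le`, `δ₁ = 2δ₀`).
[cite: Balaban1983Higgs3, (2.13) p.426] -/
structure Amp {V : Type} [Fintype V] [DecidableEq V] {m : ℕ} (M : Model V m) where
  /-- number of completed renormalization steps: `η = L^{−k}` -/
  k : ℕ
  /-- the unit cubes `□(v)` (scale `k`, positions in η-units) -/
  box : V → Fin M.d → ℕ
  /-- the vertex functions `u_v(x)` -/
  u : V → (Fin M.d → ℕ) → ℝ
  /-- the line kernels `K_l(t; x, x′)` at scale index `t` -/
  K : Fin m → ℕ → (Fin M.d → ℕ) → (Fin M.d → ℕ) → ℝ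
  /-- the constants O(1) of (2.10)–(2.12), per line -/
  C : Fin m → ℝ
  /-- the running coupling `e(L^kε)` -/
  eRun : ℝ
  /-- the running coupling `λ(L^kε)` -/
  lamRun : ℝ
  /-- the order `d_v(v)` of the vertex `v` in `e` (p. 420) -/
  dv : V → ℕ
  /-- the order `d_s(v)` of the vertex `v` in `λ` (p. 420) -/
  ds : V → ℕ
  /-- the norm of the external scalar fields localized at `v` (`1` if none) -/
  NPhi : V → ℝ
  /-- the norm of the external vector fields localized at `v` (`1` if none) -/
  NA : V → ℝ
  C_nonneg : ∀ l, 0 ≤ C l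
  eRun_nonneg : 0 ≤ eRun
  lamRun_nonneg : 0 ≤ lamRun
  NPhi_nonneg : ∀ v, 0 ≤ NPhi v
  NA_nonneg : ∀ v, 0 ≤ NA v
  /-- the *"proper power of L^{j(v)}η"* is a non-negative power -/
  e_nonneg : ∀ v, 0 ≤ M.e v
  /-- Proposition 2.1: *"Let G be a connected graph"* -/
  conn : LinesConnect M.src M.tgt
  /-- the vertex bound: external fields by their norms, `|q| ≤ 1`, `|R_{n̄+1}| ≤ 1`, couplings, the factors `η^{e_v}` -/
  u_le : ∀ v x, |u v x| ≤ eRun ^ dv v * lamRun ^ ds v * NPhi v * NA v * (((M.L : ℝ) ^ k)⁻¹) ^ M.e v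
  /-- the line bounds (2.10)–(2.12): `|K_l(t; x, x′)| ≤ C_l (L^tη)^{a_l} exp[−δ₁(L^tη)^{−1}|x − x′|]`, `δ₁ = 2δ₀`,
  `|x − x′| = η|x − x′|_∞` (η-units), for the scale indices `t ≤ k − 1` of (2.6) -/
  K_le : ∀ l t, t < k → ∀ x x',
    |K l t x x'| ≤ C l * M.sc k t ^ M.a l
      * Real.exp (-(2 * M.δ₀ / M.sc k t * (((M.L : ℝ) ^ k)⁻¹ * (supDist x x' : ℝ))))

namespace Amp

variable {V : Type} [Fintype V] [DecidableEq V] {m : ℕ} {M : Model V m} (A : Amp M)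

/-! ## Scales -/

/-- `η = L^{−k}`. [cite: Balaban1983Higgs3, (2.10) p.426] -/
noncomputable def η : ℝ := ((M.L : ℝ) ^ A.k)⁻¹

/-- `η > 0`. [cite: Balaban1983Higgs3, (2.10) p.426] -/
theorem η_pos : 0 < A.η := by
  unfold η
  have := M.L_pos_real
  positivity

/-- `L^tη = L^t · η`. [cite: Balaban1983Higgs3, (2.10) p.426] -/
theorem sc_eq (t : ℕ) : M.sc A.k t = (M.L : ℝ) ^ t * A.η := rfl

/-- `η ≤ L^tη`. [cite: Balaban1983Higgs3, (2.10) p.426] -/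
theorem η_le_sc (t : ℕ) : A.η ≤ M.sc A.k t := by
  rw [sc_eq]
  exact le_mul_of_one_le_left A.η_pos.le (one_le_pow₀ M.one_lt_L.le)

/-- `η / (L^tη) = L^{−t}`. [cite: Balaban1983Higgs3, (2.10) p.426] -/
theorem η_div_sc (t : ℕ) : A.η / M.sc A.k t = ((M.L : ℝ) ^ t)⁻¹ := by
  rw [sc_eq]
  have hη : A.η ≠ 0 := A.η_pos.ne'
  have hL : (M.L : ℝ) ^ t ≠ 0 := (pow_pos M.L_pos_real t).ne'
  field_simp

/-! ## The amplitude -/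

/-- The coupling–norm weight of the vertex `v`: `e^{d_v(v)} λ^{d_s(v)} N^Φ_v N^A_v`. [cite: Balaban1983Higgs3, (2.13) p.426] -/
noncomputable def cw (v : V) : ℝ := A.eRun ^ A.dv v * A.lamRun ^ A.ds v * A.NPhi v * A.NA v

/-- `cw v ≥ 0`. [cite: Balaban1983Higgs3, (2.13) p.426] -/
theorem cw_nonneg (v : V) : 0 ≤ A.cw v := by
  unfold cw
  have := A.eRun_nonneg
  have := A.lamRun_nonneg
  have := A.NPhi_nonneg v
  have := A.NA_nonneg v
  positivity

/-- `Π_v cw v = e^{d_v(G)} λ^{d_s(G)} (Π_v N^Φ_v)(Π_v N^A_v)` with `d_v(G) = Σ_v d_v(v)`, `d_s(G) = Σ_v d_s(v)` (p. 420).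
[cite: Balaban1983Higgs3, (1.33) p.420] -/
theorem prod_cw : ∏ v, A.cw v
    = A.eRun ^ (∑ v, A.dv v) * A.lamRun ^ (∑ v, A.ds v) * (∏ v, A.NPhi v) * ∏ v, A.NA v := by
  unfold cw
  rw [prod_mul_distrib, prod_mul_distrib, prod_mul_distrib, prod_pow_eq_pow_sum, prod_pow_eq_pow_sum]

/-- **The localized lattice graph amplitude at the scale assignment `j`**: `E_j = E(G(j), {□(v)}, Φ′_ext, A_ext) =
Σ_{x_v ∈ □(v) ∩ T_η} Π_v η^d u_v(x_v) · Π_l K_l(j_l; x_{v_l}, x_{v′_l})`. [cite: Balaban1983Higgs3, (2.13) p.426] -/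
noncomputable def E (j : Fin m → ℕ) : ℝ :=
  ∑ x ∈ boxPositions M.L A.k A.box,
    (∏ v, A.η ^ M.d * A.u v (x v)) * ∏ l, A.K l (j l) (x (M.src l)) (x (M.tgt l))

/-- The localization of a position tuple: `Δ(v)` = the cube of scale `j(v)` containing `x_v` (p. 426: *"We localize further
the expression to cubes Δ(v) of the size L^{j(v)}η"*). [cite: Balaban1983Higgs3, (2.14) p.426] -/
def loc (j : Fin m → ℕ) (x : V → Fin M.d → ℕ) : V → Cube M.d :=
  fun v => Cube.anc M.L (M.low 0 v j A.k) (pt (x v))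

/-! ## The line factors: absolute value, (2.10)–(2.12), and the split of the exponential -/

/-- One line: `|K_l(j_l; x_{v_l}, x_{v′_l})| ≤ C_l (L^{j_l}η)^{a_l} · exp[−½δ₁ η|x_{v_l} − x_{v′_l}|_∞] ·
exp[−½δ₁(L^{j_l}η)^{−1}dist(Δ(v_l), Δ(v′_l))]` — (2.10)–(2.12), then the split of the exponential factor into the part
*"estimate[d] by exp[−½δ₁dist(□(v), □(v′))]"* (kept pointwise here, `(L^{j_l}η)^{−1} ≥ 1`) and the line factor of (2.14)
(`|x − x′| ≥ dist(Δ(v), Δ(v′))` for `x ∈ Δ(v)`, `x′ ∈ Δ(v′)`). [cite: Balaban1983Higgs3, (2.13) p.426] -/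
theorem abs_K_le {j : Fin m → ℕ} (hj : j ∈ Model.Mon m A.k) (x : V → Fin M.d → ℕ) (l : Fin m) :
    |A.K l (j l) (x (M.src l)) (x (M.tgt l))|
      ≤ A.C l * M.sc A.k (j l) ^ M.a l
        * Real.exp (-(M.δ₀ * (A.η * (supDist (x (M.src l)) (x (M.tgt l)) : ℝ))))
        * M.lineF 0 j (A.loc j x) l := by
  obtain ⟨-, hjk⟩ := Model.mem_Mon.1 hj
  set s : ℝ := M.sc A.k (j l) with hs_def
  set D : ℝ := (supDist (x (M.src l)) (x (M.tgt l)) : ℝ) with hD_def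
  have hK : |A.K l (j l) (x (M.src l)) (x (M.tgt l))|
      ≤ A.C l * s ^ M.a l * Real.exp (-(2 * M.δ₀ / s * (A.η * D))) :=
    A.K_le l (j l) (hjk l) (x (M.src l)) (x (M.tgt l))
  have hs : 0 < s := M.sc_pos A.k (j l)
  have hs1 : s ≤ 1 := M.sc_le_one (hjk l).le
  have hD : 0 ≤ D := by rw [hD_def]; positivity
  have hη : 0 < A.η := A.η_pos
  have hδ : 0 < M.δ₀ := M.δ₀_pos
  have hCs : 0 ≤ A.C l * s ^ M.a l := mul_nonneg (A.C_nonneg l) (Real.rpow_nonneg hs.le _)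
  -- split exp[−2δ₀ s⁻¹ ηD] = exp[−δ₀ s⁻¹ ηD] · exp[−δ₀ s⁻¹ ηD]
  have hsplit : Real.exp (-(2 * M.δ₀ / s * (A.η * D)))
      = Real.exp (-(M.δ₀ / s * (A.η * D))) * Real.exp (-(M.δ₀ / s * (A.η * D))) := by
    rw [← Real.exp_add]
    congr 1
    ring
  -- first half: `L^{j_l}η ≤ 1`
  have h1 : Real.exp (-(M.δ₀ / s * (A.η * D))) ≤ Real.exp (-(M.δ₀ * (A.η * D))) := by
    apply Real.exp_le_exp.2
    have hle : M.δ₀ * (A.η * D) ≤ M.δ₀ / s * (A.η * D) := by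
      rw [div_mul_eq_mul_div, le_div_iff₀ hs]
      exact mul_le_of_le_one_right (by positivity) hs1
    linarith
  -- second half: the line factor of (2.14)
  have h2 : Real.exp (-(M.δ₀ / s * (A.η * D))) ≤ M.lineF 0 j (A.loc j x) l := by
    unfold Model.lineF
    simp only [Model.rep_zero, Model.δAt, pow_zero, div_one]
    apply Real.exp_le_exp.2
    have hdist : (Cube.distI M.L (A.loc j x (M.src l)) (A.loc j x (M.tgt l)) : ℝ) ≤ D := by
      rw [hD_def]
      exact_mod_cast distI_anc_pt_le M.L_pos (M.low 0 (M.src l) j A.k) (M.low 0 (M.tgt l) j A.k)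
        (x (M.src l)) (x (M.tgt l))
    have hLj : (0 : ℝ) < (M.L : ℝ) ^ j l := pow_pos M.L_pos_real _
    have e0 := A.η_div_sc (j l)
    rw [← hs_def] at e0
    have e1 : M.δ₀ / s * (A.η * D) = M.δ₀ * D / (M.L : ℝ) ^ j l := by
      rw [show M.δ₀ / s * (A.η * D) = M.δ₀ * D * (A.η / s) by ring, e0, div_eq_mul_inv]
    rw [e1]
    have : M.δ₀ * (Cube.distI M.L (A.loc j x (M.src l)) (A.loc j x (M.tgt l)) : ℝ) / (M.L : ℝ) ^ j l
        ≤ M.δ₀ * D / (M.L : ℝ) ^ j l :=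
      div_le_div_of_nonneg_right (mul_le_mul_of_nonneg_left hdist hδ.le) hLj.le
    linarith
  calc |A.K l (j l) (x (M.src l)) (x (M.tgt l))|
      ≤ A.C l * s ^ M.a l * Real.exp (-(2 * M.δ₀ / s * (A.η * D))) := hK
    _ = A.C l * s ^ M.a l * (Real.exp (-(M.δ₀ / s * (A.η * D))) * Real.exp (-(M.δ₀ / s * (A.η * D)))) := by
        rw [hsplit]
    _ ≤ A.C l * s ^ M.a l * (Real.exp (-(M.δ₀ * (A.η * D))) * M.lineF 0 j (A.loc j x) l) := by
        apply mul_le_mul_of_nonneg_left _ hCs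
        exact mul_le_mul h1 h2 (Real.exp_pos _).le (Real.exp_pos _).le
    _ = _ := by ring

/-- All lines: `Π_l |K_l| ≤ (Π_l C_l (L^{j_l}η)^{a_l}) · exp[−½δ₁ η Σ_l |x_{v_l} − x_{v′_l}|_∞] · Π_l exp[−½δ₁(L^{j_l}η)^{−1}
dist(Δ(v_l), Δ(v′_l))]` (the last product is the gen-2 `Model.EXP 0 j {Δ(v)}` of (2.14)). [cite: Balaban1983Higgs3, (2.13) p.426] -/
theorem prod_abs_K_le {j : Fin m → ℕ} (hj : j ∈ Model.Mon m A.k) (x : V → Fin M.d → ℕ) :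
    ∏ l, |A.K l (j l) (x (M.src l)) (x (M.tgt l))|
      ≤ (∏ l, A.C l * M.sc A.k (j l) ^ M.a l)
        * Real.exp (-(M.δ₀ * (A.η * ∑ l, (supDist (x (M.src l)) (x (M.tgt l)) : ℝ))))
        * M.EXP 0 j (A.loc j x) := by
  have hrem : Model.remLines m 0 = Finset.univ := by
    ext l
    simp [Model.mem_remLines]
  have hexp : ∏ l, Real.exp (-(M.δ₀ * (A.η * (supDist (x (M.src l)) (x (M.tgt l)) : ℝ))))
      = Real.exp (-(M.δ₀ * (A.η * ∑ l, (supDist (x (M.src l)) (x (M.tgt l)) : ℝ)))) := by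
    rw [← Real.exp_sum, mul_sum, mul_sum, ← sum_neg_distrib]
  have hEXP : ∏ l, M.lineF 0 j (A.loc j x) l = M.EXP 0 j (A.loc j x) := by
    unfold Model.EXP
    rw [hrem]
  calc ∏ l, |A.K l (j l) (x (M.src l)) (x (M.tgt l))|
      ≤ ∏ l, (A.C l * M.sc A.k (j l) ^ M.a l
          * Real.exp (-(M.δ₀ * (A.η * (supDist (x (M.src l)) (x (M.tgt l)) : ℝ))))
          * M.lineF 0 j (A.loc j x) l) :=
        prod_le_prod (fun l _ => abs_nonneg _) fun l _ => A.abs_K_le hj x l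
    _ = (∏ l, A.C l * M.sc A.k (j l) ^ M.a l)
          * (∏ l, Real.exp (-(M.δ₀ * (A.η * (supDist (x (M.src l)) (x (M.tgt l)) : ℝ)))))
          * ∏ l, M.lineF 0 j (A.loc j x) l := by
        rw [prod_mul_distrib, prod_mul_distrib]
    _ = _ := by rw [hexp, hEXP]

/-! ## The vertex factors -/

/-- One vertex: `η^d |u_v(x)| ≤ cw v · (η^d η^{e_v})`. [cite: Balaban1983Higgs3, (2.13) p.426] -/
theorem abs_vertex_le (v : V) (x : Fin M.d → ℕ) :
    |A.η ^ M.d * A.u v x| ≤ A.cw v * (A.η ^ M.d * A.η ^ M.e v) := by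
  rw [abs_mul, abs_of_nonneg (pow_nonneg A.η_pos.le _)]
  have h : |A.u v x| ≤ A.eRun ^ A.dv v * A.lamRun ^ A.ds v * A.NPhi v * A.NA v * A.η ^ M.e v := A.u_le v x
  have hη : 0 ≤ A.η ^ M.d := pow_nonneg A.η_pos.le _
  unfold cw
  calc A.η ^ M.d * |A.u v x|
      ≤ A.η ^ M.d * (A.eRun ^ A.dv v * A.lamRun ^ A.ds v * A.NPhi v * A.NA v * A.η ^ M.e v) :=
        mul_le_mul_of_nonneg_left h hη
    _ = _ := by ring

/-- All vertices: `Π_v η^d |u_v(x_v)| ≤ (Π_v cw v) · Π_v η^d η^{e_v}`. [cite: Balaban1983Higgs3, (2.13) p.426] -/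
theorem prod_abs_vertex_le (x : V → Fin M.d → ℕ) :
    ∏ v, |A.η ^ M.d * A.u v (x v)| ≤ (∏ v, A.cw v) * ∏ v, A.η ^ M.d * A.η ^ M.e v := by
  rw [← prod_mul_distrib]
  exact prod_le_prod (fun v _ => abs_nonneg _) fun v _ => A.abs_vertex_le v (x v)

/-! ## The first estimate of one term -/

/-- The constant in front of (2.13) at the assignment `j`, times the line powers of (2.14):
`(Π_v cw v)·(Π_l C_l (L^{j_l}η)^{a_l})·exp[−½δ₁ d({□(v)})]`. [cite: Balaban1983Higgs3, (2.13) p.426] -/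
noncomputable def Kc (j : Fin m → ℕ) : ℝ :=
  (∏ v, A.cw v) * (∏ l, A.C l * M.sc A.k (j l) ^ M.a l) * Real.exp (-(M.δ₀ * boxTreeLen M.L A.k A.box))

/-- `Kc ≥ 0`. [cite: Balaban1983Higgs3, (2.13) p.426] -/
theorem Kc_nonneg (j : Fin m → ℕ) : 0 ≤ A.Kc j := by
  unfold Kc
  refine mul_nonneg (mul_nonneg (prod_nonneg fun v _ => A.cw_nonneg v) ?_) (Real.exp_pos _).le
  exact prod_nonneg fun l _ => mul_nonneg (A.C_nonneg l) (Real.rpow_nonneg (M.sc_pos A.k (j l)).le _)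

/-- `Kc` against the line powers `Model.LP 0 k j` of (2.14): `Kc = (Π C_l)·LP·(Π cw)·exp[−½δ₁ d]`.
[cite: Balaban1983Higgs3, (2.14) p.427] -/
theorem Kc_eq (j : Fin m → ℕ) : A.Kc j
    = (∏ l, A.C l) * M.LP 0 A.k j * (∏ v, A.cw v) * Real.exp (-(M.δ₀ * boxTreeLen M.L A.k A.box)) := by
  have hrem : Model.remLines m 0 = Finset.univ := by
    ext l
    simp [Model.mem_remLines]
  unfold Kc Model.LP
  rw [hrem, prod_mul_distrib]
  ring

/-- **One localized term**, after *"taking absolute values of all factors"*, the vertex and line bounds and the extraction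
of `exp[−½δ₁ d({□(v)})]` (`B3Ineq213TreeLength.exp_sum_lines_le`): for `x_v ∈ □(v)`,
`|Π_v η^d u_v(x_v) · Π_l K_l| ≤ Kc · (Π_v η^dη^{e_v}) · Π_l exp[−½δ₁(L^{j_l}η)^{−1}dist(Δ(v_l), Δ(v′_l))]`.
[cite: Balaban1983Higgs3, (2.13) p.426] -/
theorem abs_term_le {j : Fin m → ℕ} (hj : j ∈ Model.Mon m A.k) {x : V → Fin M.d → ℕ}
    (hx : x ∈ boxPositions M.L A.k A.box) :
    |(∏ v, A.η ^ M.d * A.u v (x v)) * ∏ l, A.K l (j l) (x (M.src l)) (x (M.tgt l))|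
      ≤ A.Kc j * ((∏ v, A.η ^ M.d * A.η ^ M.e v) * M.EXP 0 j (A.loc j x)) := by
  rw [abs_mul, Finset.abs_prod, Finset.abs_prod]
  have hV := A.prod_abs_vertex_le x
  have hL := A.prod_abs_K_le hj x
  have htree : Real.exp (-(M.δ₀ * (A.η * ∑ l, (supDist (x (M.src l)) (x (M.tgt l)) : ℝ))))
      ≤ Real.exp (-(M.δ₀ * boxTreeLen M.L A.k A.box)) := by
    have h := exp_sum_lines_le (L := M.L) (k := A.k) (box := A.box) A.conn hx M.δ₀_pos.le
    unfold η
    exact h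
  have hcw : 0 ≤ ∏ v, A.cw v := prod_nonneg fun v _ => A.cw_nonneg v
  have hvx : 0 ≤ ∏ v, A.η ^ M.d * A.η ^ M.e v :=
    prod_nonneg fun v _ => mul_nonneg (pow_nonneg A.η_pos.le _) (Real.rpow_nonneg A.η_pos.le _)
  have hCs : 0 ≤ ∏ l, A.C l * M.sc A.k (j l) ^ M.a l :=
    prod_nonneg fun l _ => mul_nonneg (A.C_nonneg l) (Real.rpow_nonneg (M.sc_pos A.k (j l)).le _)
  have hEXP : 0 ≤ M.EXP 0 j (A.loc j x) := (M.EXP_pos 0 j _).le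
  calc (∏ v, |A.η ^ M.d * A.u v (x v)|) * ∏ l, |A.K l (j l) (x (M.src l)) (x (M.tgt l))|
      ≤ ((∏ v, A.cw v) * ∏ v, A.η ^ M.d * A.η ^ M.e v)
          * ((∏ l, A.C l * M.sc A.k (j l) ^ M.a l)
            * Real.exp (-(M.δ₀ * (A.η * ∑ l, (supDist (x (M.src l)) (x (M.tgt l)) : ℝ))))
            * M.EXP 0 j (A.loc j x)) :=
        mul_le_mul hV hL (prod_nonneg fun l _ => abs_nonneg _) (mul_nonneg hcw hvx)
    _ ≤ ((∏ v, A.cw v) * ∏ v, A.η ^ M.d * A.η ^ M.e v)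
          * ((∏ l, A.C l * M.sc A.k (j l) ^ M.a l) * Real.exp (-(M.δ₀ * boxTreeLen M.L A.k A.box))
            * M.EXP 0 j (A.loc j x)) := by
        apply mul_le_mul_of_nonneg_left _ (mul_nonneg hcw hvx)
        apply mul_le_mul_of_nonneg_right _ hEXP
        exact mul_le_mul_of_nonneg_left htree hCs
    _ = _ := by unfold Kc; ring

end Amp

end Literature.MathematicalPhysics.QuantumFieldTheory.Balaban1983to89.B3Ineq213
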